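import Summits.ResolutionOfSingularities.ResolutionOfSingularities.Theorems.PurelyInseparableDim4ResConeTameSlices
import Summits.ResolutionOfSingularities.ResolutionOfSingularities.Theorems.PurelyInseparableDim4AboveFloorBaseChange
import HarnessLib

/-!
# K2(p)'s SLICES MAY BE CHECKED OVER ALGEBRAICALLY CLOSED FIELDS (cell `res-dim4-pi`, K2(p) lane)

[OURS · counted 0 · AI work weaker than expert review.]  Cell `res-dim4-pi` (D-0157 DOOR 2), seat `res-dim4-p-3` g3
(brick «slices_algClosed», desk WORDS #75 / #77 (c)).  Bookkeeping only — NOTHING here proves K2(p)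
(`RidgeBudget.NoAboveFloorTrap p p`), `NoIsolatedTrap p p`, the Cossart–Jannsen–Saito theorem or resolution of
singularities in dimension ≥ 4 / characteristic `p`.

res-dim4-p-12 g2 split K2(p) into three slices (`ResCone.noAboveFloorTrap_iff_slices`, p673049) and, with
res-dim4-p-7 g2's `…ResConeSliceA`, into the two TAME slices (`ResCone.noAboveFloorTrap_iff_tameSlices`, p673897):
K2(p) ⟺ over EVERY field of characteristic `p` there is no located power-cone chain (`1 ≤ d < p`, `e_G ≡ 3`) and
no located binary-cone chain (`1 ≤ d < p`, `e_G ≡ 2`).  This file (the lineage's `K2BaseChange.locatedChain_map`,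
p673195) removes the quantifier over all fields: **each slice need only be emptied over ALGEBRAICALLY CLOSED
fields** (so a slice holder may take p-th roots of coefficients, split binary forms into linear factors, and give
every non-constant form in ≥ 2 variables a non-trivial zero, at no cost).

* §1 `no_tameSlice_of_forall_isAlgClosed` (`e` a parameter: `e = 3` is slice B, `e = 2` is slice C) and
  `no_wildSlice_of_forall_isAlgClosed` (slice A binder): a slice empty over every algebraically closed field of
  characteristic `p` is empty over every field of characteristic `p`.
* §2 `noAboveFloorTrap_of_no_tameSlices_algClosed` (the assembly form the slice holders discharge BY NAME),
  `noAboveFloorTrap_iff_tameSlices_algClosed`, `noAboveFloorTrap_iff_slices_algClosed`, and the PERFECT-field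
  forms.

bears_on: LADDER-RESOLUTION:D157-DOOR2 (res-dim4-pi · K2(p)).  Supports stmt-ResolutionOfSingularities-16155
(helper).
-/

set_option linter.dupNamespace false -- mandated namespace of this single-conjunct summit

noncomputable section

namespace Summit.ResolutionOfSingularities.ResolutionOfSingularities.Theorems.PIDim4

namespace K2BaseChange

open MvPolynomial
open Literature.AlgebraicGeometry.Resolution
open Literature.AlgebraicGeometry.Resolution.CentreBlowup
open Literature.AlgebraicGeometry.Resolution.Hauser2010
open Literature.AlgebraicGeometry.Resolution.HauserPerlega2019
open RidgeBudget (NoAboveFloorTrap)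
open ResCone (resForm resVertex)

/-! ## §1 A slice empty over algebraically closed fields is empty over all fields -/

/-- **TAME SLICES GO UP**: if no algebraically closed field of characteristic `p` carries a located chain with
constant shade `1 ≤ d < p` and constant `e_G = e` (`x^{r₀} ∣ F₀`, isolated, `Step0 p`, above the floor), then no
field of characteristic `p` does (`e = 3`: slice B, power cones; `e = 2`: slice C, binary cones).
[OURS · bookkeeping] [folklore] -/
theorem no_tameSlice_of_forall_isAlgClosed (p e : ℕ)
    (h : ∀ (L : Type) [Field L] [IsAlgClosed L] [CharP L p] [DecidableEq L],
      ¬ ∃ (c : ℕ → State L) (d : ℕ), 1 ≤ d ∧ d < p ∧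
          (∀ e' ∈ (c 0).F.support, (c 0).r ≤ e') ∧
          ∀ k, IsIsolated p (c k).F ∧ Step0 p (c k) (c (k + 1)) ∧ ordZero (c k).F ≠ p ∧
            (c k).shade = (d : ℕ∞) ∧ Module.finrank L (resVertex (c k)) = e)
    (K : Type) [Field K] [CharP K p] [DecidableEq K] :
    ¬ ∃ (c : ℕ → State K) (d : ℕ), 1 ≤ d ∧ d < p ∧
        (∀ e' ∈ (c 0).F.support, (c 0).r ≤ e') ∧
        ∀ k, IsIsolated p (c k).F ∧ Step0 p (c k) (c (k + 1)) ∧ ordZero (c k).F ≠ p ∧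
          (c k).shade = (d : ℕ∞) ∧ Module.finrank K (resVertex (c k)) = e := by
  rintro ⟨c, d, hd1, hdp, hr0, hc⟩
  letI : DecidableEq (AlgebraicClosure K) := Classical.decEq _
  obtain ⟨hr0', hc'⟩ := locatedChain_map (algebraMap K (AlgebraicClosure K)) hr0 hc
  exact h (AlgebraicClosure K) ⟨_, d, hd1, hdp, hr0', hc'⟩

/-- **THE WILD SLICE GOES UP**: if no algebraically closed field of characteristic `p` carries a located chain
of wild shade `p ≤ d` (`2d + 4 ≤ 3p`, constant `e_G = e ∈ [2, 4]`), then no field of characteristic `p` does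
(slice A; already EMPTY over every field by res-dim4-p-7 g2's `…ResConeSliceA` — recorded for symmetry).
[OURS · bookkeeping] [folklore] -/
theorem no_wildSlice_of_forall_isAlgClosed (p : ℕ)
    (h : ∀ (L : Type) [Field L] [IsAlgClosed L] [CharP L p] [DecidableEq L],
      ¬ ∃ (c : ℕ → State L) (d e : ℕ), p ≤ d ∧ 2 * d + 4 ≤ 3 * p ∧ 2 ≤ e ∧ e ≤ 4 ∧
          (∀ e' ∈ (c 0).F.support, (c 0).r ≤ e') ∧
          ∀ k, IsIsolated p (c k).F ∧ Step0 p (c k) (c (k + 1)) ∧ ordZero (c k).F ≠ p ∧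
            (c k).shade = (d : ℕ∞) ∧ Module.finrank L (resVertex (c k)) = e)
    (K : Type) [Field K] [CharP K p] [DecidableEq K] :
    ¬ ∃ (c : ℕ → State K) (d e : ℕ), p ≤ d ∧ 2 * d + 4 ≤ 3 * p ∧ 2 ≤ e ∧ e ≤ 4 ∧
        (∀ e' ∈ (c 0).F.support, (c 0).r ≤ e') ∧
        ∀ k, IsIsolated p (c k).F ∧ Step0 p (c k) (c (k + 1)) ∧ ordZero (c k).F ≠ p ∧
          (c k).shade = (d : ℕ∞) ∧ Module.finrank K (resVertex (c k)) = e := by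
  rintro ⟨c, d, e, hpd, hd2, he2, he4, hr0, hc⟩
  letI : DecidableEq (AlgebraicClosure K) := Classical.decEq _
  obtain ⟨hr0', hc'⟩ := locatedChain_map (algebraMap K (AlgebraicClosure K)) hr0 hc
  exact h (AlgebraicClosure K) ⟨_, d, e, hpd, hd2, he2, he4, hr0', hc'⟩

/-! ## §2 K2(p) from the slices over algebraically closed fields -/

/-- **K2(p) FROM THE TWO TAME SLICES OVER ALGEBRAICALLY CLOSED FIELDS** (`p` prime; the assembly form): if no
algebraically closed field of characteristic `p` carries a located power-cone chain (`1 ≤ d < p`, `e_G ≡ 3`) and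
none carries a located binary-cone chain (`1 ≤ d < p`, `e_G ≡ 2`), then `RidgeBudget.NoAboveFloorTrap p p`.
(p-12 g2's `ResCone.noAboveFloorTrap_iff_tameSlices` + §1.) [OURS · bookkeeping]
[cite: CossartJannsenSaito2020, Thm. 3.14] -/
theorem noAboveFloorTrap_of_no_tameSlices_algClosed (p : ℕ) [Fact p.Prime]
    (hB : ∀ (L : Type) [Field L] [IsAlgClosed L] [CharP L p] [DecidableEq L],
      ¬ ∃ (c : ℕ → State L) (d : ℕ), 1 ≤ d ∧ d < p ∧
          (∀ e' ∈ (c 0).F.support, (c 0).r ≤ e') ∧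
          ∀ k, IsIsolated p (c k).F ∧ Step0 p (c k) (c (k + 1)) ∧ ordZero (c k).F ≠ p ∧
            (c k).shade = (d : ℕ∞) ∧ Module.finrank L (resVertex (c k)) = 3)
    (hC : ∀ (L : Type) [Field L] [IsAlgClosed L] [CharP L p] [DecidableEq L],
      ¬ ∃ (c : ℕ → State L) (d : ℕ), 1 ≤ d ∧ d < p ∧
          (∀ e' ∈ (c 0).F.support, (c 0).r ≤ e') ∧
          ∀ k, IsIsolated p (c k).F ∧ Step0 p (c k) (c (k + 1)) ∧ ordZero (c k).F ≠ p ∧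
            (c k).shade = (d : ℕ∞) ∧ Module.finrank L (resVertex (c k)) = 2) :
    NoAboveFloorTrap p p := by
  rw [ResCone.noAboveFloorTrap_iff_tameSlices p]
  intro K _ _ _
  exact ⟨no_tameSlice_of_forall_isAlgClosed p 3 (fun L _ _ _ _ => hB L) K,
    no_tameSlice_of_forall_isAlgClosed p 2 (fun L _ _ _ _ => hC L) K⟩

/-- **K2(p) ⟺ THE TWO TAME SLICES ARE EMPTY OVER ALGEBRAICALLY CLOSED FIELDS** (`p` prime): the
`[IsAlgClosed L]` form of p-12 g2's `ResCone.noAboveFloorTrap_iff_tameSlices`. [OURS · bookkeeping]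
[cite: CossartJannsenSaito2020, Thm. 3.14] -/
theorem noAboveFloorTrap_iff_tameSlices_algClosed (p : ℕ) [Fact p.Prime] :
    NoAboveFloorTrap p p ↔ ∀ (L : Type) [Field L] [IsAlgClosed L] [CharP L p] [DecidableEq L],
      (¬ ∃ (c : ℕ → State L) (d : ℕ), 1 ≤ d ∧ d < p ∧
          (∀ e' ∈ (c 0).F.support, (c 0).r ≤ e') ∧
          ∀ k, IsIsolated p (c k).F ∧ Step0 p (c k) (c (k + 1)) ∧ ordZero (c k).F ≠ p ∧
            (c k).shade = (d : ℕ∞) ∧ Module.finrank L (resVertex (c k)) = 3) ∧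
      (¬ ∃ (c : ℕ → State L) (d : ℕ), 1 ≤ d ∧ d < p ∧
          (∀ e' ∈ (c 0).F.support, (c 0).r ≤ e') ∧
          ∀ k, IsIsolated p (c k).F ∧ Step0 p (c k) (c (k + 1)) ∧ ordZero (c k).F ≠ p ∧
            (c k).shade = (d : ℕ∞) ∧ Module.finrank L (resVertex (c k)) = 2) := by
  refine ⟨fun h L _ _ _ _ => ((ResCone.noAboveFloorTrap_iff_tameSlices p).mp h) L, fun h => ?_⟩
  exact noAboveFloorTrap_of_no_tameSlices_algClosed p (fun L _ _ _ _ => (h L).1) (fun L _ _ _ _ => (h L).2)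

/-- **K2(p) ⟺ THE THREE SLICES ARE EMPTY OVER ALGEBRAICALLY CLOSED FIELDS** (`p` prime): the
`[IsAlgClosed L]` form of p-12 g2's `ResCone.noAboveFloorTrap_iff_slices` (slice A rides along; it is empty
over every field by `…ResConeSliceA`). [OURS · bookkeeping] [cite: CossartJannsenSaito2020, Thm. 3.14] -/
theorem noAboveFloorTrap_iff_slices_algClosed (p : ℕ) [Fact p.Prime] :
    NoAboveFloorTrap p p ↔ ∀ (L : Type) [Field L] [IsAlgClosed L] [CharP L p] [DecidableEq L],
      (¬ ∃ (c : ℕ → State L) (d e : ℕ), p ≤ d ∧ 2 * d + 4 ≤ 3 * p ∧ 2 ≤ e ∧ e ≤ 4 ∧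
          (∀ e' ∈ (c 0).F.support, (c 0).r ≤ e') ∧
          ∀ k, IsIsolated p (c k).F ∧ Step0 p (c k) (c (k + 1)) ∧ ordZero (c k).F ≠ p ∧
            (c k).shade = (d : ℕ∞) ∧ Module.finrank L (resVertex (c k)) = e) ∧
      (¬ ∃ (c : ℕ → State L) (d : ℕ), 1 ≤ d ∧ d < p ∧
          (∀ e' ∈ (c 0).F.support, (c 0).r ≤ e') ∧
          ∀ k, IsIsolated p (c k).F ∧ Step0 p (c k) (c (k + 1)) ∧ ordZero (c k).F ≠ p ∧
            (c k).shade = (d : ℕ∞) ∧ Module.finrank L (resVertex (c k)) = 3) ∧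
      (¬ ∃ (c : ℕ → State L) (d : ℕ), 1 ≤ d ∧ d < p ∧
          (∀ e' ∈ (c 0).F.support, (c 0).r ≤ e') ∧
          ∀ k, IsIsolated p (c k).F ∧ Step0 p (c k) (c (k + 1)) ∧ ordZero (c k).F ≠ p ∧
            (c k).shade = (d : ℕ∞) ∧ Module.finrank L (resVertex (c k)) = 2) := by
  refine ⟨fun h L _ _ _ _ => ((ResCone.noAboveFloorTrap_iff_slices p).mp h) L, fun h => ?_⟩
  exact noAboveFloorTrap_of_no_tameSlices_algClosed p (fun L _ _ _ _ => (h L).2.1)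
    (fun L _ _ _ _ => (h L).2.2)

/-- **K2(p) from the two tame slices over PERFECT fields** (`p` prime). [OURS · bookkeeping]
[cite: CossartJannsenSaito2020, Thm. 3.14] -/
theorem noAboveFloorTrap_of_no_tameSlices_perfectField (p : ℕ) [Fact p.Prime]
    (hB : ∀ (L : Type) [Field L] [CharP L p] [PerfectField L] [DecidableEq L],
      ¬ ∃ (c : ℕ → State L) (d : ℕ), 1 ≤ d ∧ d < p ∧
          (∀ e' ∈ (c 0).F.support, (c 0).r ≤ e') ∧
          ∀ k, IsIsolated p (c k).F ∧ Step0 p (c k) (c (k + 1)) ∧ ordZero (c k).F ≠ p ∧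
            (c k).shade = (d : ℕ∞) ∧ Module.finrank L (resVertex (c k)) = 3)
    (hC : ∀ (L : Type) [Field L] [CharP L p] [PerfectField L] [DecidableEq L],
      ¬ ∃ (c : ℕ → State L) (d : ℕ), 1 ≤ d ∧ d < p ∧
          (∀ e' ∈ (c 0).F.support, (c 0).r ≤ e') ∧
          ∀ k, IsIsolated p (c k).F ∧ Step0 p (c k) (c (k + 1)) ∧ ordZero (c k).F ≠ p ∧
            (c k).shade = (d : ℕ∞) ∧ Module.finrank L (resVertex (c k)) = 2) :
    NoAboveFloorTrap p p :=
  noAboveFloorTrap_of_no_tameSlices_algClosed p (fun L _ _ _ _ => hB L) (fun L _ _ _ _ => hC L)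

/-- **K2(p) ⟺ the two tame slices are empty over PERFECT fields** (`p` prime). [OURS · bookkeeping]
[cite: CossartJannsenSaito2020, Thm. 3.14] -/
theorem noAboveFloorTrap_iff_tameSlices_perfectField (p : ℕ) [Fact p.Prime] :
    NoAboveFloorTrap p p ↔ ∀ (L : Type) [Field L] [CharP L p] [PerfectField L] [DecidableEq L],
      (¬ ∃ (c : ℕ → State L) (d : ℕ), 1 ≤ d ∧ d < p ∧
          (∀ e' ∈ (c 0).F.support, (c 0).r ≤ e') ∧
          ∀ k, IsIsolated p (c k).F ∧ Step0 p (c k) (c (k + 1)) ∧ ordZero (c k).F ≠ p ∧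
            (c k).shade = (d : ℕ∞) ∧ Module.finrank L (resVertex (c k)) = 3) ∧
      (¬ ∃ (c : ℕ → State L) (d : ℕ), 1 ≤ d ∧ d < p ∧
          (∀ e' ∈ (c 0).F.support, (c 0).r ≤ e') ∧
          ∀ k, IsIsolated p (c k).F ∧ Step0 p (c k) (c (k + 1)) ∧ ordZero (c k).F ≠ p ∧
            (c k).shade = (d : ℕ∞) ∧ Module.finrank L (resVertex (c k)) = 2) := by
  refine ⟨fun h L _ _ _ _ => ((ResCone.noAboveFloorTrap_iff_tameSlices p).mp h) L, fun h => ?_⟩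
  exact noAboveFloorTrap_of_no_tameSlices_perfectField p (fun L _ _ _ _ => (h L).1)
    (fun L _ _ _ _ => (h L).2)

end K2BaseChange

end Summit.ResolutionOfSingularities.ResolutionOfSingularities.Theorems.PIDim4

end
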